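import Summits.QuantumFields.YangMills.Theorems.IR.Negative.TypOnsetFloorPoly.PlaqEnergy
import Summits.QuantumFields.YangMills.Theorems.LangevinControlUVFemtoCurvatureTwoPointCHyperplaneTwist

/-!
# Crux `IR` (stmt-QuantumFields-19354) — the POLYNOMIAL ROW FLOOR `b⋆_T(β) ≥ c·(β / log β)^{1/7}` for EVERY compact gauge group,
# part 7/10: §4i every plaquette of Σ touches Λ (K1″ ⇐ K1‴), §4j Lipschitz bounds of the boundary action (sections `Action`, `Lipschitz`)

Re-homed VERBATIM (statements, proofs, names; namespace `…Cruxes.IR.CruxIdea2g7` ↦ `…Cruxes.IR.RowFloorPoly`) from the crux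
workfile `Cruxes/IR/CruxIdea2RowFloorPoly.lean` rev 14 (sha16 742d7312ea0b5c70; author `ym-cruxidea-19354-2` GEN 7; kernel certificate
`Cruxes/IR/CruxIdea2RowFloorPolyCert.lean` rev 1, sha16 59d3cfe64fab9c7c, gate-elaborated stub-free) per owner R114 (2) (landing seat:
the `ym-19354-disprove-1` lineage, g9), split by its sections into ten ≤ 400-line modules chained by import; the module docstring of
record (history, theorem map, honest framing) is in the headline module `Theorems/IR/Negative/TypOnsetFloorPoly.lean` (part 10/10).
Negative knowledge for stmt-QuantumFields-19354 (`--supports`; closes no stub); not mixing, not a mass gap, nothing about Clay.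
-/

set_option autoImplicit false

noncomputable section

open MeasureTheory Filter Topology
open Literature.MathematicalPhysics.QuantumLattice
open Literature.Probability.LatticeModels
open Summit.QuantumFields.YangMills.Cruxes.IR.Tempered (cellEdges windowCells regionEdges)
open Summit.QuantumFields.YangMills.Cruxes.IR.ShellTempered (windowCellsPlus)
open Summit.QuantumFields.YangMills.Cruxes.IR.OnsetFormats (TypShellCond shellCount)
open Summit.QuantumFields.YangMills.Cruxes.IR.FixedMesh
open Summit.QuantumFields.YangMills.Cruxes.IR.FixedMeshAllG
open Summit.QuantumFields.YangMills.Theorems.FemtoCurvatureTwoPoint.DoublingOfRV (norm_rho_mul_sub_one_le norm_rho_inv_sub_one)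
open Summit.QuantumFields.YangMills.Cruxes.IR.HairpinStokes (norm_map_conj_sub_one sub_re_trace_eq_norm_sq)
open Literature.MathematicalPhysics.QuantumFieldTheory (abs_re_trace_le_sqrt_mul re_trace_map_inv)
open Summit.QuantumFields.YangMills.Theorems.FemtoCurvatureTwoPointC.TorusGauge.TwistLower (norm_rho_mul_sub_rho_mul_le norm_rho_inv_sub_rho_inv)

namespace Summit.QuantumFields.YangMills.Cruxes.IR.RowFloorPoly

/-! ## §4i (PROVED; rev 9) Every plaquette of `Σ` touches `Λ`: K1″ reduces to the kernel-mean of the BOUNDARY WILSON ACTION (K1‴) -/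

section Action

open scoped Matrix Matrix.Norms.Frobenius
open Literature.MathematicalPhysics.QuantumFieldTheory (wilsonMeasure GaugeConfig isProbabilityMeasure_wilsonMeasure)
open Summit.QuantumFields.YangMills.Theorems.TunedSequenceExists.Negative.Freezing (integrable_of_continuous)

variable {G : Type} [Group G] [TopologicalSpace G] [IsTopologicalGroup G] [CompactSpace G]
  [SecondCountableTopology G] [MeasurableSpace G] [BorelSpace G]
  {N : ℕ} (ρ : G →* Matrix (Fin N) (Fin N) ℂ)

/-- The `Σ`-plaquette `(t, s)` of the row rectangle as a `ZdPlaquette 4` (base `site2 t s`, plane `(0,1)`). -/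
def sigmaPlaq (t s : ℤ) : ZdPlaquette 4 := (site2 t s, ⟨((0 : Fin 4), (1 : Fin 4)), by decide⟩)

/-- Helper lemma `sigmaPlaq_inj` of the row-floor chain (re-homed verbatim from the crux workfile; see the module docstring). -/
theorem sigmaPlaq_inj {t s t' s' : ℤ} (h : sigmaPlaq t s = sigmaPlaq t' s') : t = t' ∧ s = s' := by
  have h1 := congrArg (fun p : ZdPlaquette 4 => p.1 0) h
  have h2 := congrArg (fun p : ZdPlaquette 4 => p.1 1) h
  simp only [sigmaPlaq, site2_zero, site2_one] at h1 h2
  exact ⟨h1, h2⟩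

/-- **Geometry (PROVED):** every edge `(site2 t s, i)` with `1 ≤ t ≤ b`, `0 ≤ s < (2n+1)b` lies in the resampled row region
`Λ = rowRegion b n` (cell `y = (0, ⌊s/b⌋, 0, 0) ∈ rowCells n` of the standard frame). -/
theorem edge_mem_rowRegion {b n : ℕ} (hb : 1 ≤ b) {t : ℤ} (ht : 1 ≤ t ∧ t ≤ b) {s : ℤ}
    (hs : 0 ≤ s ∧ s < (2 * n + 1) * (b : ℤ)) (i : Fin 4) : (site2 t s, i) ∈ rowRegion b n := by
  have hb0 : (0 : ℤ) < b := by exact_mod_cast hb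
  set q : ℤ := s / b with hq
  have hdiv := Int.mul_ediv_add_emod s b
  have hr0 := Int.emod_nonneg s hb0.ne'
  have hrb := Int.emod_lt_of_pos s hb0
  have hq0 : 0 ≤ q := Int.ediv_nonneg hs.1 hb0.le
  have hqn : q < 2 * n + 1 := (Int.ediv_lt_iff_lt_mul hb0).2 (by linarith [hs.2])
  let y : Fin 4 → ℤ := fun k => if k = 1 then q else 0
  unfold rowRegion regionEdges
  rw [Finset.mem_biUnion]
  refine ⟨y, ?_, ?_⟩
  · refine Finset.mem_filter.2 ⟨?_, by simp [y]⟩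
    rw [windowCells, Fintype.mem_piFinset]
    intro k
    rw [Finset.mem_Icc]
    fin_cases k <;> simp [y]
    all_goals omega
  · rw [cellEdges, Finset.mem_product]
    refine ⟨?_, Finset.mem_univ _⟩
    rw [Fintype.mem_piFinset]
    intro k
    rw [Finset.mem_Ico]
    fin_cases k <;> simp [y, site2, stdFrame] <;> (try constructor) <;>
      nlinarith [hdiv, hr0, hrb, hq0, hqn, ht.1, ht.2, hb0]

/-- `site2 0 s + e₀ = site2 1 s`. -/
theorem site2_zero_add_single (s : ℤ) : site2 0 s + Pi.single (0 : Fin 4) (1 : ℤ) = site2 1 s := by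
  funext k
  fin_cases k <;> simp [site2]

/-- **Geometry (PROVED): every plaquette of the spanning surface `Σ = [0,b] × [0,(2n+1)b)` touches `Λ = rowRegion b n`**
(through its spatial edge at height `max t 1`). -/
theorem sigmaPlaq_mem_touching {b n : ℕ} (hb : 1 ≤ b) {t s : ℕ} (ht : t ≤ b) (hs : s < (2 * n + 1) * b) :
    sigmaPlaq t s ∈ plaquettesTouching (rowRegion b n) := by
  rw [mem_plaquettesTouching_iff]
  have hs' : (0 : ℤ) ≤ (s : ℤ) ∧ (s : ℤ) < (2 * n + 1) * (b : ℤ) := ⟨by positivity, by exact_mod_cast hs⟩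
  rcases Nat.eq_zero_or_pos t with rfl | htpos
  · refine ⟨(site2 1 s, (1 : Fin 4)), Finset.mem_inter.2 ⟨?_, ?_⟩⟩
    · simp only [plaquetteEdges, sigmaPlaq, Finset.mem_insert, Finset.mem_singleton, Nat.cast_zero]
      right; left
      rw [site2_zero_add_single]
    · exact edge_mem_rowRegion hb ⟨le_rfl, by exact_mod_cast hb⟩ hs' 1
  · refine ⟨(site2 t s, (1 : Fin 4)), Finset.mem_inter.2 ⟨?_, ?_⟩⟩
    · simp [plaquetteEdges, sigmaPlaq]
    · exact edge_mem_rowRegion hb ⟨by exact_mod_cast htpos, by exact_mod_cast ht⟩ hs' 1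

omit [TopologicalSpace G] [IsTopologicalGroup G] [CompactSpace G] [SecondCountableTopology G] [MeasurableSpace G]
  [BorelSpace G] in
/-- **E1 (PROVED): the film's plaquette energy on `Σ` is dominated by twice the boundary Wilson action of `Λ`,**
`Σ_{p∈Σ} ‖ρ(U_p) − 1‖²_F ≤ 2 · wilsonBoundaryAction ρ (rowRegion b n) U` for every configuration `U`
(`‖ρ(U_p) − 1‖²_F = 2(N − Re tr ρ(U_p))`, `Σ ⊆ plaquettesTouching Λ`, and every summand of the action is `≥ 0`). -/
theorem plaqDefectSqSum_le_two_mul_action (hρu : ∀ g, ρ g ∈ Matrix.unitaryGroup (Fin N) ℂ) {b : ℕ} (hb : 1 ≤ b)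
    (n : ℕ) (U : LGConfig 4 G) :
    plaqDefectSqSum ρ b ((2 * n + 1) * b) U ≤ 2 * wilsonBoundaryAction ρ (rowRegion b n) U := by
  rw [plaqDefectSqSum_eq_two_mul_sum_cost ρ hρu]
  refine mul_le_mul_of_nonneg_left ?_ (by norm_num)
  unfold wilsonBoundaryAction
  set S := Finset.range ((2 * n + 1) * b) ×ˢ Finset.range (b + 1) with hS
  let g : ℕ × ℕ → ZdPlaquette 4 := fun q => sigmaPlaq q.2 q.1
  have hsub : S.image g ⊆ plaquettesTouching (rowRegion b n) := by
    refine Finset.image_subset_iff.2 fun q hq => ?_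
    obtain ⟨hq1, hq2⟩ := Finset.mem_product.1 hq
    exact sigmaPlaq_mem_touching hb (Nat.lt_succ_iff.1 (Finset.mem_range.1 hq2)) (Finset.mem_range.1 hq1)
  have hnn : ∀ p ∈ plaquettesTouching (rowRegion b n), p ∉ S.image g →
      0 ≤ (N : ℝ) - plaquetteObs ρ p.1 p.2.1.1 p.2.1.2 U := fun p _ _ => by
    have := (abs_le.1 (abs_plaquetteObs_le_holds ρ hρu p.1 p.2.1.1 p.2.1.2 U)).2
    linarith
  have himg : ∑ p ∈ S.image g, ((N : ℝ) - plaquetteObs ρ p.1 p.2.1.1 p.2.1.2 U) =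
      ∑ q ∈ S, ((N : ℝ) - plaquetteObs ρ (g q).1 (g q).2.1.1 (g q).2.1.2 U) := by
    refine Finset.sum_image ?_
    intro q _ q' _ hqq
    obtain ⟨h1, h2⟩ := sigmaPlaq_inj hqq
    exact Prod.ext (by exact_mod_cast h2) (by exact_mod_cast h1)
  calc ∑ s ∈ Finset.range ((2 * n + 1) * b), ∑ t ∈ Finset.range (b + 1), ((N : ℝ) - (ρ (plaq U t s)).trace.re)
      = ∑ q ∈ S, ((N : ℝ) - plaquetteObs ρ (g q).1 (g q).2.1.1 (g q).2.1.2 U) := by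
        rw [hS, Finset.sum_product]
        rfl
    _ = ∑ p ∈ S.image g, ((N : ℝ) - plaquetteObs ρ p.1 p.2.1.1 p.2.1.2 U) := himg.symm
    _ ≤ ∑ p ∈ plaquettesTouching (rowRegion b n), ((N : ℝ) - plaquetteObs ρ p.1 p.2.1.1 p.2.1.2 U) :=
        Finset.sum_le_sum_of_subset_of_nonneg hsub hnn

/-- The kernel-mean BOUNDARY WILSON ACTION of `Λ = rowRegion b n` in the twisted world:
`V ↦ E_{γ_Λ(·|σ'_V)} wilsonBoundaryAction ρ Λ`, `σ'_V = topTwist_b(comb_b k₀ σ) σ`, `σ = lift V`. -/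
def kernelAction (β : ℝ) (b n : ℕ) (k₀ : G) (V : GaugeConfig 4 (2 * ((2 * n + 2) * b + 1) + 1) G) : ℝ :=
  ∫ U, wilsonBoundaryAction ρ (rowRegion b n) U
    ∂(ymSpecification ρ β (rowRegion b n)
      (twistΦ b (comb b ((2 * n + 2) * b + 1) k₀) (torusLift (2 * ((2 * n + 2) * b + 1) + 1) V)))

omit [SecondCountableTopology G] in
/-- Helper lemma `kernelAction_nonneg` of the row-floor chain (re-homed verbatim from the crux workfile; see the module docstring). -/
theorem kernelAction_nonneg (hρu : ∀ g, ρ g ∈ Matrix.unitaryGroup (Fin N) ℂ) (β : ℝ) (b n : ℕ) (k₀ : G)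
    (V : GaugeConfig 4 (2 * ((2 * n + 2) * b + 1) + 1) G) : 0 ≤ kernelAction ρ β b n k₀ V :=
  integral_nonneg fun U => wilsonBoundaryAction_nonneg ρ hρu _ U

/-- `V ↦ kernelAction V` is continuous (as `continuous_kernelPlaqDefectSq`). -/
theorem continuous_kernelAction (hρ : Continuous ρ) (hρu : ∀ g, ρ g ∈ Matrix.unitaryGroup (Fin N) ℂ) (β : ℝ)
    (b n : ℕ) (k₀ : G) : Continuous (kernelAction ρ β b n k₀) := by
  have hker := continuous_integral_ymSpecification ρ hρ β (rowRegion b n)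
    (continuous_wilsonBoundaryAction ρ hρ (rowRegion b n))
    (C := 2 * N * (plaquettesTouching (rowRegion b n)).card)
    (fun U => by
      rw [abs_of_nonneg (wilsonBoundaryAction_nonneg ρ hρu _ U)]
      exact wilsonBoundaryAction_le_card ρ hρu _ U)
  have hbd : Continuous fun V : GaugeConfig 4 (2 * ((2 * n + 2) * b + 1) + 1) G =>
      twistΦ b (comb b ((2 * n + 2) * b + 1) k₀) (torusLift (2 * ((2 * n + 2) * b + 1) + 1) V) :=
    (continuous_twist_comb b _ k₀).comp (continuous_torusLift _)
  exact hker.comp hbd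

/-- **K1″ ⇐ K1‴ pointwise (PROVED):** `kernelPlaqDefectSq V ≤ 2 · kernelAction V`. -/
theorem kernelPlaqDefectSq_le_kernelAction (hρ : Continuous ρ) (hρu : ∀ g, ρ g ∈ Matrix.unitaryGroup (Fin N) ℂ)
    (β : ℝ) {b : ℕ} (hb : 1 ≤ b) (n : ℕ) (k₀ : G) (V : GaugeConfig 4 (2 * ((2 * n + 2) * b + 1) + 1) G) :
    kernelPlaqDefectSq ρ β b n k₀ V ≤ 2 * kernelAction ρ β b n k₀ V := by
  unfold kernelPlaqDefectSq kernelAction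
  set γ := ymSpecification ρ β (rowRegion b n)
    (twistΦ b (comb b ((2 * n + 2) * b + 1) k₀) (torusLift (2 * ((2 * n + 2) * b + 1) + 1) V)) with hγ
  haveI : IsProbabilityMeasure γ := isProbabilityMeasure_ymSpecification ρ hρ β _ _
  rw [← integral_const_mul]
  exact integral_mono (integrable_of_continuous γ (continuous_plaqDefectSqSum ρ hρ _ _))
    ((integrable_of_continuous γ (continuous_wilsonBoundaryAction ρ hρ _)).const_mul 2)
    fun U => plaqDefectSqSum_le_two_mul_action ρ hρu hb n U

/-- **K1″ ⇐ K1‴ with the rates (PROVED):** an in-mean bound `E_μ E_γ A_Λ ≤ C b⁵ log β/β` on the kernel-mean boundary Wilson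
action gives the plaquette-energy bound K1″ with constant `2C`. -/
theorem integral_kernelPlaqDefectSq_le_of_action (hρ : Continuous ρ) (hρu : ∀ g, ρ g ∈ Matrix.unitaryGroup (Fin N) ℂ)
    {n : ℕ} {k₀ : G}
    (h : ∃ C : ℝ, 0 < C ∧ ∃ β₁ : ℝ, ∀ β : ℝ, β₁ ≤ β → ∀ b : ℕ, 1 ≤ b →
      ∫ V, kernelAction ρ β b n k₀ V ∂(wilsonMeasure (d := 4) (L := 2 * ((2 * n + 2) * b + 1) + 1) ρ β) ≤
        C * (b : ℝ) ^ 5 * (Real.log β / β)) :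
    ∃ C : ℝ, 0 < C ∧ ∃ β₁ : ℝ, ∀ β : ℝ, β₁ ≤ β → ∀ b : ℕ, 1 ≤ b →
      ∫ V, kernelPlaqDefectSq ρ β b n k₀ V ∂(wilsonMeasure (d := 4) (L := 2 * ((2 * n + 2) * b + 1) + 1) ρ β) ≤
        C * (b : ℝ) ^ 5 * (Real.log β / β) := by
  obtain ⟨C, hC, β₁, h⟩ := h
  refine ⟨2 * C, by positivity, β₁, fun β hβ b hb => ?_⟩
  set μ := wilsonMeasure (d := 4) (L := 2 * ((2 * n + 2) * b + 1) + 1) ρ β with hμ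
  haveI : IsProbabilityMeasure μ := isProbabilityMeasure_wilsonMeasure ρ hρ β
  calc ∫ V, kernelPlaqDefectSq ρ β b n k₀ V ∂μ ≤ ∫ V, 2 * kernelAction ρ β b n k₀ V ∂μ :=
        integral_mono (integrable_of_continuous μ (continuous_kernelPlaqDefectSq ρ hρ hρu β b n k₀))
          ((integrable_of_continuous μ (continuous_kernelAction ρ hρ hρu β b n k₀)).const_mul 2)
          fun V => kernelPlaqDefectSq_le_kernelAction ρ hρ hρu β hb n k₀ V
    _ = 2 * ∫ V, kernelAction ρ β b n k₀ V ∂μ := integral_const_mul _ _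
    _ ≤ 2 * (C * (b : ℝ) ^ 5 * (Real.log β / β)) := mul_le_mul_of_nonneg_left (h β hβ b hb) (by norm_num)
    _ = 2 * C * (b : ℝ) ^ 5 * (Real.log β / β) := by ring

end Action

/-! ## §4j (PROVED; rev 10) Energy–entropy for the kernel-mean ACTION against a reference filling: Lipschitz bounds of
`A_Λ` in Frobenius balls, product small-ball Haar mass around ANY centre (Chatterjee Cor. 6.3 via the tree's
`FreeEnergyLogCoefficient.exists_haar_gball_ge` + left invariance), and the assembly K1‴ ⇐ R1 ∧ R3 -/

section Lipschitz

open scoped Matrix Matrix.Norms.Frobenius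

variable {G : Type} [Group G] {d N : ℕ} (ρ : G →* Matrix (Fin N) (Fin N) ℂ)

/-- The total Frobenius deviation of `ρ ∘ U` from `ρ ∘ U'` on the four edges of the plaquette `(x, i, j)`. -/
def plaqEdgeDev (U U' : LGConfig d G) (x : Site d) (i j : Fin d) : ℝ :=
  ‖ρ (U (x, i)) - ρ (U' (x, i))‖ + ‖ρ (U (x + Pi.single i 1, j)) - ρ (U' (x + Pi.single i 1, j))‖ +
    ‖ρ (U (x + Pi.single j 1, i)) - ρ (U' (x + Pi.single j 1, i))‖ + ‖ρ (U (x, j)) - ρ (U' (x, j))‖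

/-- Helper lemma `plaqEdgeDev_nonneg` of the row-floor chain (re-homed verbatim from the crux workfile; see the module docstring). -/
theorem plaqEdgeDev_nonneg (U U' : LGConfig d G) (x : Site d) (i j : Fin d) : 0 ≤ plaqEdgeDev ρ U U' x i j := by
  unfold plaqEdgeDev; positivity

/-- **Telescoping (PROVED):** `‖ρ(U_p) − ρ(U'_p)‖_F ≤` the sum of the four edge deviations. -/
theorem norm_map_plaquetteHolonomy_sub_le (hρu : ∀ g, ρ g ∈ Matrix.unitaryGroup (Fin N) ℂ) (U U' : LGConfig d G)
    (x : Site d) (i j : Fin d) :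
    ‖ρ (plaquetteHolonomyZd U x i j) - ρ (plaquetteHolonomyZd U' x i j)‖ ≤ plaqEdgeDev ρ U U' x i j := by
  unfold plaquetteHolonomyZd plaqEdgeDev
  calc ‖ρ (U (x, i) * U (x + Pi.single i 1, j) * (U (x + Pi.single j 1, i))⁻¹ * (U (x, j))⁻¹) -
        ρ (U' (x, i) * U' (x + Pi.single i 1, j) * (U' (x + Pi.single j 1, i))⁻¹ * (U' (x, j))⁻¹)‖
      ≤ ‖ρ (U (x, i) * U (x + Pi.single i 1, j) * (U (x + Pi.single j 1, i))⁻¹) -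
          ρ (U' (x, i) * U' (x + Pi.single i 1, j) * (U' (x + Pi.single j 1, i))⁻¹)‖ +
          ‖ρ (U (x, j))⁻¹ - ρ (U' (x, j))⁻¹‖ := norm_rho_mul_sub_rho_mul_le ρ hρu _ _ _ _
    _ ≤ (‖ρ (U (x, i) * U (x + Pi.single i 1, j)) - ρ (U' (x, i) * U' (x + Pi.single i 1, j))‖ +
          ‖ρ (U (x + Pi.single j 1, i))⁻¹ - ρ (U' (x + Pi.single j 1, i))⁻¹‖) +
          ‖ρ (U (x, j))⁻¹ - ρ (U' (x, j))⁻¹‖ := by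
        gcongr; exact norm_rho_mul_sub_rho_mul_le ρ hρu _ _ _ _
    _ ≤ ((‖ρ (U (x, i)) - ρ (U' (x, i))‖ + ‖ρ (U (x + Pi.single i 1, j)) - ρ (U' (x + Pi.single i 1, j))‖) +
          ‖ρ (U (x + Pi.single j 1, i))⁻¹ - ρ (U' (x + Pi.single j 1, i))⁻¹‖) +
          ‖ρ (U (x, j))⁻¹ - ρ (U' (x, j))⁻¹‖ := by
        gcongr; exact norm_rho_mul_sub_rho_mul_le ρ hρu _ _ _ _
    _ = _ := by rw [norm_rho_inv_sub_rho_inv ρ hρu, norm_rho_inv_sub_rho_inv ρ hρu]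

/-- **Lipschitz bound of one plaquette observable (PROVED):** `|obs_p(U) − obs_p(U')| ≤ √N · (edge deviations)`. -/
theorem abs_plaquetteObs_sub_le (hρu : ∀ g, ρ g ∈ Matrix.unitaryGroup (Fin N) ℂ) (U U' : LGConfig d G)
    (x : Site d) (i j : Fin d) :
    |plaquetteObs ρ x i j U - plaquetteObs ρ x i j U'| ≤ Real.sqrt N * plaqEdgeDev ρ U U' x i j := by
  unfold plaquetteObs
  rw [← Complex.sub_re, ← Matrix.trace_sub]
  exact (abs_re_trace_le_sqrt_mul _).trans
    (mul_le_mul_of_nonneg_left (norm_map_plaquetteHolonomy_sub_le ρ hρu U U' x i j) (Real.sqrt_nonneg _))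

/-- **Lipschitz bound of the boundary Wilson action (PROVED):**
`A_Λ(U) ≤ A_Λ(U') + √N · Σ_{p touching Λ} (edge deviations of p)`. -/
theorem wilsonBoundaryAction_le_add_dev (hρu : ∀ g, ρ g ∈ Matrix.unitaryGroup (Fin N) ℂ) (Λ : Finset (ZdEdge d))
    (U U' : LGConfig d G) :
    wilsonBoundaryAction ρ Λ U ≤ wilsonBoundaryAction ρ Λ U' +
      Real.sqrt N * ∑ p ∈ plaquettesTouching Λ, plaqEdgeDev ρ U U' p.1 p.2.1.1 p.2.1.2 := by
  unfold wilsonBoundaryAction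
  rw [Finset.mul_sum, ← Finset.sum_add_distrib]
  refine Finset.sum_le_sum fun p _ => ?_
  have h := (abs_le.1 (abs_plaquetteObs_sub_le ρ hρu U' U p.1 p.2.1.1 p.2.1.2)).2
  have hsym : plaqEdgeDev ρ U' U p.1 p.2.1.1 p.2.1.2 = plaqEdgeDev ρ U U' p.1 p.2.1.1 p.2.1.2 := by
    unfold plaqEdgeDev; simp only [norm_sub_rev]
  rw [hsym] at h
  linarith

/-- **Small-ball slack (PROVED):** if `ρ ∘ U` is within Frobenius distance `r` of `ρ ∘ U'` on every edge of `Λ` and `U = U'`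
off `Λ`, then `A_Λ(U) ≤ A_Λ(U') + 4√N · #touching(Λ) · r`. -/
theorem wilsonBoundaryAction_le_of_ball (hρu : ∀ g, ρ g ∈ Matrix.unitaryGroup (Fin N) ℂ) (Λ : Finset (ZdEdge d))
    {U U' : LGConfig d G} {r : ℝ} (hr : 0 ≤ r) (hin : ∀ e ∈ Λ, ‖ρ (U e) - ρ (U' e)‖ ≤ r)
    (hout : ∀ e, e ∉ Λ → U e = U' e) :
    wilsonBoundaryAction ρ Λ U ≤ wilsonBoundaryAction ρ Λ U' + 4 * Real.sqrt N * (plaquettesTouching Λ).card * r := by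
  have hdev : ∀ e, ‖ρ (U e) - ρ (U' e)‖ ≤ r := fun e => by
    by_cases he : e ∈ Λ
    · exact hin e he
    · rw [hout e he, sub_self, norm_zero]; exact hr
  have hp : ∀ p ∈ plaquettesTouching Λ, plaqEdgeDev ρ U U' p.1 p.2.1.1 p.2.1.2 ≤ 4 * r := fun p _ => by
    unfold plaqEdgeDev; linarith [hdev (p.1, p.2.1.1), hdev (p.1 + Pi.single p.2.1.1 1, p.2.1.2),
      hdev (p.1 + Pi.single p.2.1.2 1, p.2.1.1), hdev (p.1, p.2.1.2)]
  have hsum : ∑ p ∈ plaquettesTouching Λ, plaqEdgeDev ρ U U' p.1 p.2.1.1 p.2.1.2 ≤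
      (plaquettesTouching Λ).card * (4 * r) := by
    have := Finset.sum_le_sum hp
    rwa [Finset.sum_const, nsmul_eq_mul] at this
  have hN : 0 ≤ Real.sqrt N := Real.sqrt_nonneg _
  calc wilsonBoundaryAction ρ Λ U ≤ wilsonBoundaryAction ρ Λ U' +
        Real.sqrt N * ∑ p ∈ plaquettesTouching Λ, plaqEdgeDev ρ U U' p.1 p.2.1.1 p.2.1.2 :=
        wilsonBoundaryAction_le_add_dev ρ hρu Λ U U'
    _ ≤ wilsonBoundaryAction ρ Λ U' + Real.sqrt N * ((plaquettesTouching Λ).card * (4 * r)) := by gcongr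
    _ = wilsonBoundaryAction ρ Λ U' + 4 * Real.sqrt N * (plaquettesTouching Λ).card * r := by ring



end Lipschitz

end Summit.QuantumFields.YangMills.Cruxes.IR.RowFloorPoly

end
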